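import Mathlib
import Literature.NumberTheory.Transcendental.ExpDominantSolvabilityContraction
import Literature.ModelTheory.Zilber.EACRationalLines
import Literature.ModelTheory.Zilber.EACDensityProofs
import Literature.ModelTheory.Zilber.EACGraphFibres
import Literature.ModelTheory.Zilber.EACSubcellCertificates
import HarnessLib
import HarnessLib.Audit

/-!
# Mantova–Masser's question on the density of the UNPROJECTED exponential points:
# the question typed (OPEN in general), and their example (fermat) DECIDED

Mantova–Masser, *Polynomial-exponential equations — some new cases of solvability*, Proc. LMS (2024)
= arXiv:2303.05592, §1 "Further remarks" (p. 5). Having proved (Theorem 1.2) that for an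
irreducible surface `S ⊆ ℂ² × ℂ*²` the PROJECTIONS `π(Z)` of the exponential points
`Z = Z_S = {(z, e^z) ∈ S}` are Zariski dense in `π(S)` whenever `Z` is infinite, the authors write:

> "It is also natural to consider the distribution of the unprojected points (SZ). In the situation
> of [BM2017] the trick extends at once to show that they are Zariski dense in `V` itself. [...]
> In our situation the analogous statement is unclear, even for `n = 2`. This is illustrated by
> case (dim-pi-S-1-free) in Theorem (thm2). Just for the example (fermat) [`X₁⁹ + X₂⁹ = 1`,
> `X̂₁ + X̂₂ = 1`] the density in `S` would amount to the fact that there is no `G ≠ 0` in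
> `ℂ[X₁,X̂₁]` such that `G(z,e^z) = 0` for all `z` with `e^z + e^{⁹√(1-z⁹)} = 1`, which does
> not seem obvious. In fact this case (dim-pi-S-1-free) is the only problem [...]"

Case (dim-pi-S-1-free) of their Theorem 1.2 (p. 4) is "`dim π(S) = 1` and the Zariski closure of
`π(S)` is not a line of rational slope" — typed in the tree as the named fact
`mantovaMasser2024_thm_1_2_notLRS` (`EACRationalLines`), whose conclusion is `π(Z)` infinite.

## Contents

**Part I (the question, OPEN in general).** The dictionary of `EAC.lean` / `EACRationalLines.lean`
(`S = W ∩ G²`, `π = projAdd`, `Z = W ∩ expGraph ℂ 2`, "dense in `S`" = "`I(Z) = I(W)`" =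
`UnprojectedDense W`; the hypotheses of case (dim-pi-S-1-free) = `MMCaseDimPiOneFree W`). The
question "`∀ W, MMCaseDimPiOneFree W → UnprojectedDense W`?" is a QUESTION in print, neither proved
nor conjectured there; it is NOT registered here as a statement (a Literature file mints no open
statements) and appears only as an explicit hypothesis of two remarks. Around it: the dominant case
`dim π(V) = n`
(`vanishingIdeal_inter_expGraph_of_addProjDim_eq`: Brownawell–Masser's trick, the tree theorem
`EACDensityProofs.vanishingIdeal_inter_expGraph`; Aslanyan–Kirby–Mantova, IMRN 2023, Thm. 1.3 ff.),
and "density ⇒ existence" (`ecCell_two_one_of_unprojectedDense`).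

**Parts A–E (new here: decided instances).** An elementary mechanism — *degenerate escape plus
Liouville elimination* — answers the question affirmatively for Mantova–Masser's own example:

* (A) `eq_zero_of_eval₂_eq_zero_of_superdecay`: if `G ∈ ℂ[z][w]` vanishes at `(z_k, w_k)` with
  `‖z_k‖ → ∞`, `w_k ≠ 0` and `‖w_k‖ ‖z_k‖^N → 0` for all `N`, then `G = 0`.
* (B) `exists_exp_eq_one_sub_of_small` (from the tree's contraction lemma
  `ExpDominant.exists_exp_eq_one_add` with `n = 1`): `e^z = 1 - P(z)` has a solution within `1/2` of
  any `c ∈ 2πiℤ` when `‖P‖ ≤ 1/32` on the unit disc around `c`. Near `2πik` the second exponential of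
  `e^z + e^{x₂} = 1` is super-polynomially small in the *degenerate* regime `Re x₂ → -∞`
  (`x₂ = z²`: `Re z² ≤ -23k`; `x₂ = ⁹√(1-z⁹)` on the branch `η z (1 - z⁻⁹)^{1/9}`, `η = e^{iπ/3}`:
  `Re x₂ ≤ -4k`), which produces infinitely many exponential points `(z_k, ·, 1 - w_k, w_k)` with
  `w_k` super-polynomially small against `z_k`.
* (C) `vanishingIdeal_mmParabola_inter_expGraph`: for `S_par = {x₁ = x₀², y₀ + y₁ = 1}` (example
  (fermat) with the Fermat nonic replaced by the parabola) the exponential points are Zariski dense,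
  `I(S_par ∩ Γ_exp) = I(S_par)`; `S_par` satisfies every hypothesis of the question (Part E,
  `unprojectedDensityQuestion_instance_mmParabola`: irreducible surface, `dim cl π(S) = 1`, not a line
  of rational slope) — an instance of case (dim-pi-S-1-free) in which the answer is YES.
* (D) `mantovaMasser_fermat_noRelation`: **Mantova–Masser's sentence for (fermat) itself** — there is
  no `G ≠ 0` in `ℂ[X₁, X̂₁]` with `G(z, e^z) = 0` for all `z` such that some ninth root `s` of
  `1 - z⁹` has `e^z + e^s = 1` (their multivalued `⁹√`). That this sentence is equivalent to density
  in the Fermat surface is Mantova–Masser's remark ("would amount to": a norm argument over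
  `ℂ(x₁)`), NOT formalised here; for `S_par`, whose coordinate ring is `ℂ[x₀, y₁]`, the full
  ideal-theoretic density IS formalised.

HONEST FRAMING. The general question (Part I) stays OPEN: the mechanism needs a *degenerate*
regime (one exponential tending to `0` along a sequence of solutions), which e.g. the oscillatory
surfaces over `x₁ = a x₀` (`a` real irrational) do not offer. What is decided is Mantova–Masser's
flagged example and a sibling, by an elementary argument (possibly folklore to experts — we found no
statement of it; searches recorded in the pub-cell notes). Nothing here bears on the open cell
`ECCell 3 2` of the pub-schanuel ladder, nor on Schanuel's conjecture (EAC ⇏ SC).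
-/

noncomputable section

open Filter Topology MvPolynomial

namespace Literature.ModelTheory.Zilber

open Literature.NumberTheory.Transcendental

/-! ## Part I. The question (OPEN) and what is known around it -/

/-- **The hypotheses of Mantova–Masser's case (dim-pi-S-1-free)** (Thm. 1.2, p. 4) on
`W ⊆ ℂ² × ℂ²`, in the dictionary of `mantovaMasser2024_thm_1_2_notLRS`: `W` irreducible Zariski
closed of dimension `2`, torus part `S = W ∩ G²` non-empty, `dim cl π(S) = 1`, and `cl π(S)` not a
line of rational slope. (A definition transcribing their case distinction; no claim.)
[cite: MantovaMasser2023, Thm. 1.2 case (dim-pi-S-1-free), p. 4] -/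
def MMCaseDimPiOneFree (W : Set (Fin 2 ⊕ Fin 2 → ℂ)) : Prop :=
  IsIrreducibleClosed ℂ W ∧ (W ∩ torusLocus ℂ 2).Nonempty ∧ zariskiDim ℂ W = (2 : ℕ) ∧
    addProjDim ℂ 2 W = (1 : ℕ) ∧
    ¬ IsRationalSlopeLine (zeroLocus ℂ (vanishingIdeal ℂ (projAdd '' (W ∩ torusLocus ℂ 2))))

/-- **"The unprojected exponential points are Zariski dense in `S`"** for `W ⊆ ℂⁿ × ℂⁿ`:
`I(W ∩ Γ_exp) = I(W)` (for `W` Zariski closed equivalently `cl(W ∩ Γ_exp) = W`,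
`zeroLocus_vanishingIdeal_inter_expGraph_of_eq` / `vanishingIdeal_inter_expGraph_eq_of_zeroLocus_eq`).
In this dictionary Mantova–Masser's Further remark (§1 p. 5) asks whether
`MMCaseDimPiOneFree W → UnprojectedDense W` for every `W`; see the module docstring for the status
and for what this file proves (`W = S_par`, Part E; their sentence for (fermat), Part D).
(A definition of a property of `W`; no claim.) [folklore] -/
def UnprojectedDense {n : ℕ} (W : Set (Fin n ⊕ Fin n → ℂ)) : Prop :=
  vanishingIdeal ℂ (W ∩ expGraph ℂ n) = vanishingIdeal ℂ W

/-- The set-theoretic reading of "`I(W ∩ Γ_exp) = I(W)`" for a Zariski closed `W`: the Zariski closure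
`Z(I(W ∩ Γ_exp))` of the exponential points is all of `W`. [folklore] -/
theorem zeroLocus_vanishingIdeal_inter_expGraph_of_eq {n : ℕ} {W : Set (Fin n ⊕ Fin n → ℂ)}
    (hW : IsZariskiClosed ℂ W) (h : vanishingIdeal ℂ (W ∩ expGraph ℂ n) = vanishingIdeal ℂ W) :
    zeroLocus ℂ (vanishingIdeal ℂ (W ∩ expGraph ℂ n)) = W := by
  rw [h]
  exact (eq_zeroLocus_vanishingIdeal_of_isZariskiClosed hW).symm

/-- Conversely, if the Zariski closure of the exponential points is `W`, then `I(W ∩ Γ_exp) = I(W)`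
(`I ∘ Z ∘ I = I`). [folklore] -/
theorem vanishingIdeal_inter_expGraph_eq_of_zeroLocus_eq {n : ℕ} {W : Set (Fin n ⊕ Fin n → ℂ)}
    (h : zeroLocus ℂ (vanishingIdeal ℂ (W ∩ expGraph ℂ n)) = W) :
    vanishingIdeal ℂ (W ∩ expGraph ℂ n) = vanishingIdeal ℂ W := by
  refine le_antisymm ?_ (vanishingIdeal_anti_mono Set.inter_subset_left)
  conv_rhs => rw [← h]
  exact le_vanishingIdeal_zeroLocus _

/-- **Density forces existence.** For any `W ≠ ∅`: if `I(W ∩ Γ_exp) = I(W)` then `W` has an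
exponential point — otherwise `1 ∈ I(∅) = I(W)`. [folklore] -/
theorem inter_expGraph_nonempty_of_vanishingIdeal_eq {n : ℕ} {W : Set (Fin n ⊕ Fin n → ℂ)}
    (hne : W.Nonempty) (h : vanishingIdeal ℂ (W ∩ expGraph ℂ n) = vanishingIdeal ℂ W) :
    (W ∩ expGraph ℂ n).Nonempty := by
  by_contra hempty
  rw [Set.not_nonempty_iff_eq_empty] at hempty
  obtain ⟨w, hw⟩ := hne
  have h1 : (1 : MvPolynomial (Fin n ⊕ Fin n) ℂ) ∈ vanishingIdeal ℂ W := by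
    rw [← h, mem_vanishingIdeal_iff]
    intro z hz
    rw [hempty] at hz
    exact absurd hz (Set.notMem_empty z)
  have h10 := (mem_vanishingIdeal_iff.mp h1) w hw
  simp at h10

/-- **An affirmative answer would be at least as strong as existence in the same case**: IF
`MMCaseDimPiOneFree W → UnprojectedDense W` for all `W` (Mantova–Masser's open question, taken here
as an explicit HYPOTHESIS, not asserted), then the aperiodic sub-cell `ECCellAperiodic 1` holds ("no
integer period" is "closure of `π(S)` not a line of rational slope",
`hasIntegerPeriod_projAdd_iff_isRationalSlopeLine`; the freeness hypotheses of the cell are not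
used) — exactly as Mantova–Masser's Thm. 1.2 (case not-(LRS)) does
(`ecCellAperiodic_one_of_mantovaMasser_thm_1_2`). [folklore] -/
theorem ecCellAperiodic_one_of_unprojectedDense
    (h : ∀ W, MMCaseDimPiOneFree W → UnprojectedDense W) : ECCellAperiodic 1 := by
  intro W hW hne _hadd _hmul hdim hbase hper
  have hnl : ¬ IsRationalSlopeLine
      (zeroLocus ℂ (vanishingIdeal ℂ (projAdd '' (W ∩ torusLocus ℂ 2)))) := fun hL =>
    hper ((hasIntegerPeriod_projAdd_iff_isRationalSlopeLine hW hne hbase).2 hL)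
  exact inter_expGraph_nonempty_of_vanishingIdeal_eq (hne.mono Set.inter_subset_left)
    (h W ⟨hW, hne, hdim, hbase, hnl⟩)

/-- Hence an affirmative answer would give the (decided, granted MM24 Thm. 1.2) cell `EC(2, 1)`
(`ecCell_two_one_iff_ecCellAperiodic_one`); the question itself is a hypothesis here, not asserted.
[folklore] -/
theorem ecCell_two_one_of_unprojectedDense
    (h : ∀ W, MMCaseDimPiOneFree W → UnprojectedDense W) : ECCell 2 1 :=
  ecCell_two_one_iff_ecCellAperiodic_one.2 (ecCellAperiodic_one_of_unprojectedDense h)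

/-- **The dominant case is known, for every `n`** (Mantova–Masser 2024 §1 p. 5: "In the situation of
[BM2017]" — `dim π(V) = n` — "the trick extends at once to show that they are Zariski dense in `V`
itself"): for `W ⊆ ℂⁿ × ℂⁿ` irreducible Zariski closed with `dim cl π(W ∩ Gⁿ) = n`, `I(W ∩ Γ_exp) = I(W)`.
This is the tree theorem `vanishingIdeal_inter_expGraph` (Aslanyan–Kirby–Mantova 2023 Thm. 5.1, via
the lifted variety `liftEqns`) under the cell-style hypothesis `addProjDim ℂ n W = n`
(`vanishingIdeal_eq_bot_of_zariskiDim_eq`). [cite: MantovaMasser2023, §1 p. 5 (Further remarks)] -/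
theorem vanishingIdeal_inter_expGraph_of_addProjDim_eq {n : ℕ} {W : Set (Fin n ⊕ Fin n → ℂ)}
    (hW : IsIrreducibleClosed ℂ W) (hproj : addProjDim ℂ n W = n) :
    vanishingIdeal ℂ (W ∩ expGraph ℂ n) = vanishingIdeal ℂ W :=
  vanishingIdeal_inter_expGraph hW
    ((hasDominantAddProjection_iff_vanishingIdeal_eq_bot _).2
      (vanishingIdeal_eq_bot_of_zariskiDim_eq hproj))

/-- In particular the `n = 2`, `dim π(S) = 2` bullet of Mantova–Masser's Thm. 1.2 holds in the
unprojected form: for an irreducible surface with dominant additive projection the exponential points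
are Zariski dense in `S` itself, `cl Z = W`. [cite: MantovaMasser2023, §1 p. 5 (Further remarks)] -/
theorem zeroLocus_vanishingIdeal_inter_expGraph_of_addProjDim_eq_two {W : Set (Fin 2 ⊕ Fin 2 → ℂ)}
    (hW : IsIrreducibleClosed ℂ W) (hproj : addProjDim ℂ 2 W = (2 : ℕ)) :
    zeroLocus ℂ (vanishingIdeal ℂ (W ∩ expGraph ℂ 2)) = W :=
  zeroLocus_vanishingIdeal_inter_expGraph_of_eq hW.1
    (vanishingIdeal_inter_expGraph_of_addProjDim_eq hW hproj)

/-! ### A. Liouville-type elimination: polynomial growth versus super-polynomial decay -/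

section Elimination

/-- Crude growth bound `‖p(x)‖ ≤ (Σ ‖pᵢ‖) · max(1, ‖x‖)^{deg p}`. [folklore] -/
theorem norm_eval_le_sum_mul_pow (p : Polynomial ℂ) (x : ℂ) :
    ‖p.eval x‖ ≤ (∑ i ∈ Finset.range (p.natDegree + 1), ‖p.coeff i‖) *
      max 1 ‖x‖ ^ p.natDegree := by
  rw [Polynomial.eval_eq_sum_range, Finset.sum_mul]
  refine (norm_sum_le _ _).trans (Finset.sum_le_sum fun i hi => ?_)
  rw [norm_mul, norm_pow]
  refine mul_le_mul_of_nonneg_left ?_ (norm_nonneg _)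
  calc ‖x‖ ^ i ≤ max 1 ‖x‖ ^ i := pow_le_pow_left₀ (norm_nonneg _) (le_max_right _ _) i
    _ ≤ max 1 ‖x‖ ^ p.natDegree :=
        pow_le_pow_right₀ (le_max_left _ _) (Nat.lt_succ_iff.mp (Finset.mem_range.mp hi))

/-- **Polynomial growth loses to super-polynomial decay**: if `‖w_k‖ ‖z_k‖^N → 0` for every `N`,
then `‖p(z_k)‖ ‖w_k‖ → 0` for every polynomial `p`. [folklore] -/
theorem tendsto_norm_eval_mul_of_superdecay (p : Polynomial ℂ) (z w : ℕ → ℂ)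
    (hdec : ∀ N : ℕ, Tendsto (fun k => ‖w k‖ * ‖z k‖ ^ N) atTop (𝓝 0)) :
    Tendsto (fun k => ‖p.eval (z k)‖ * ‖w k‖) atTop (𝓝 0) := by
  set B := ∑ i ∈ Finset.range (p.natDegree + 1), ‖p.coeff i‖ with hB_def
  have hB : 0 ≤ B := Finset.sum_nonneg fun i _ => norm_nonneg _
  have hle : ∀ k, ‖p.eval (z k)‖ * ‖w k‖ ≤
      B * (‖w k‖ * ‖z k‖ ^ 0 + ‖w k‖ * ‖z k‖ ^ p.natDegree) := by
    intro k
    have h1 := norm_eval_le_sum_mul_pow p (z k)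
    have h2 : max 1 ‖z k‖ ^ p.natDegree ≤ 1 + ‖z k‖ ^ p.natDegree := by
      rcases le_total ‖z k‖ 1 with h | h
      · rw [max_eq_left h, one_pow]
        exact le_add_of_nonneg_right (pow_nonneg (norm_nonneg _) _)
      · rw [max_eq_right h]
        exact le_add_of_nonneg_left zero_le_one
    calc ‖p.eval (z k)‖ * ‖w k‖ ≤ (B * max 1 ‖z k‖ ^ p.natDegree) * ‖w k‖ :=
          mul_le_mul_of_nonneg_right h1 (norm_nonneg _)
      _ ≤ (B * (1 + ‖z k‖ ^ p.natDegree)) * ‖w k‖ :=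
          mul_le_mul_of_nonneg_right (mul_le_mul_of_nonneg_left h2 hB) (norm_nonneg _)
      _ = B * (‖w k‖ * ‖z k‖ ^ 0 + ‖w k‖ * ‖z k‖ ^ p.natDegree) := by ring
  have hlim : Tendsto (fun k => B * (‖w k‖ * ‖z k‖ ^ 0 + ‖w k‖ * ‖z k‖ ^ p.natDegree))
      atTop (𝓝 0) := by
    have := ((hdec 0).add (hdec p.natDegree)).const_mul B
    simpa using this
  exact squeeze_zero (fun k => mul_nonneg (norm_nonneg _) (norm_nonneg _)) hle hlim

/-- **Elimination lemma** (Liouville-type). Let `G ∈ ℂ[z][w]`. If `G(z_k, w_k) = 0` along a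
sequence with `‖z_k‖ → ∞`, `w_k ≠ 0` and `‖w_k‖ ‖z_k‖^N → 0` for every `N` (super-polynomial
decay of `w_k` against `z_k`), then `G = 0`: writing `G = w^m Q` with `Q(z, 0) ≠ 0`, the identity
`Q(z_k, 0) = -Σ_{j ≥ 1} Q_j(z_k) w_k^j → 0` contradicts `‖Q(z_k, 0)‖ → ∞` (or `= const ≠ 0`).
[folklore] -/
theorem eq_zero_of_eval₂_eq_zero_of_superdecay (G : Polynomial (Polynomial ℂ)) (z w : ℕ → ℂ)
    (hz : Tendsto (fun k => ‖z k‖) atTop atTop) (hw : ∀ k, w k ≠ 0)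
    (hdec : ∀ N : ℕ, Tendsto (fun k => ‖w k‖ * ‖z k‖ ^ N) atTop (𝓝 0))
    (hG : ∀ k, G.eval₂ (Polynomial.evalRingHom (z k)) (w k) = 0) : G = 0 := by
  by_contra hG0
  obtain ⟨Q, hGQ, hdvd⟩ := G.exists_eq_pow_rootMultiplicity_mul_and_not_dvd hG0 0
  rw [map_zero, sub_zero] at hGQ hdvd
  rw [Polynomial.X_dvd_iff] at hdvd
  have hQ : ∀ k, Q.eval₂ (Polynomial.evalRingHom (z k)) (w k) = 0 := by
    intro k
    have h := hG k
    rw [hGQ, Polynomial.eval₂_mul, Polynomial.eval₂_X_pow] at h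
    exact (mul_eq_zero.mp h).resolve_left (pow_ne_zero _ (hw k))
  have hq0 : ∀ k, (Q.coeff 0).eval (z k) =
      -∑ i ∈ Finset.range Q.natDegree, (Q.coeff (i + 1)).eval (z k) * w k ^ (i + 1) := by
    intro k
    have h := hQ k
    rw [Polynomial.eval₂_eq_sum_range, Finset.sum_range_succ'] at h
    simp only [Polynomial.coe_evalRingHom, pow_zero, mul_one] at h
    linear_combination h
  have hw0 : Tendsto (fun k => ‖w k‖) atTop (𝓝 0) := by simpa using hdec 0
  have hterm : ∀ i ∈ Finset.range Q.natDegree, Tendsto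
      (fun k => ‖(Q.coeff (i + 1)).eval (z k) * w k ^ (i + 1)‖) atTop (𝓝 0) := by
    intro i _
    have h1 := tendsto_norm_eval_mul_of_superdecay (Q.coeff (i + 1)) z w hdec
    have hev : ∀ᶠ k in atTop, ‖w k‖ ≤ 1 :=
      (hw0.eventually (gt_mem_nhds zero_lt_one)).mono fun k hk => hk.le
    refine squeeze_zero_norm' (hev.mono fun k hk => ?_) h1
    rw [norm_norm, norm_mul, norm_pow, pow_succ, ← mul_assoc]
    exact mul_le_mul_of_nonneg_right
      (mul_le_of_le_one_right (norm_nonneg _) (pow_le_one₀ (norm_nonneg _) hk)) (norm_nonneg _)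
  have hsum := tendsto_finsetSum (Finset.range Q.natDegree) hterm
  rw [Finset.sum_const_zero] at hsum
  have hlim : Tendsto (fun k => ‖(Q.coeff 0).eval (z k)‖) atTop (𝓝 0) := by
    refine squeeze_zero (fun k => norm_nonneg _) (fun k => ?_) hsum
    rw [hq0 k, norm_neg]
    exact norm_sum_le _ _
  rcases le_or_gt (Q.coeff 0).degree 0 with hdeg | hdeg
  swap
  · exact hlim.not_tendsto (disjoint_nhds_atTop 0) ((Q.coeff 0).tendsto_norm_atTop hdeg hz)
  · have hC := Polynomial.eq_C_of_degree_le_zero hdeg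
    rw [hC] at hlim
    simp only [Polynomial.eval_C] at hlim
    have h0 := tendsto_nhds_unique tendsto_const_nhds hlim
    rw [norm_eq_zero] at h0
    exact hdvd (by rw [hC, h0, map_zero])

end Elimination

/-! ### B. Degenerate escape near `2πiℤ` -/

section Escape

open Complex

/-- **One contraction step**: if `e^c = 1` and `P` is holomorphic with `‖P‖ ≤ 1/32` on the unit
disc around `c`, then `e^z = 1 - P(z)` has a solution with `‖z - c‖ ≤ 1/2` (from the
`n = 1` case of `ExpDominant.exists_exp_eq_one_add`). [folklore] -/
theorem exists_exp_eq_one_sub_of_small (c : ℂ) (hc : exp c = 1) (P : ℂ → ℂ)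
    (hP : DifferentiableOn ℂ P (Metric.ball c 1))
    (hb : ∀ z ∈ Metric.ball c 1, ‖P z‖ ≤ 1 / 32) :
    ∃ z : ℂ, ‖z - c‖ ≤ 1 / 2 ∧ exp z = 1 - P z := by
  have hmaps : Set.MapsTo (fun ξ : Fin 1 → ℂ => c + ξ 0) (Metric.ball 0 1) (Metric.ball c 1) := by
    intro ξ hξ
    rw [Metric.mem_ball, dist_zero_right] at hξ
    rw [Metric.mem_ball, dist_eq_norm, add_sub_cancel_left]
    exact (norm_le_pi_norm ξ 0).trans_lt hξ
  have hlin : Differentiable ℂ (fun ξ : Fin 1 → ℂ => c + ξ 0) :=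
    (differentiable_const c).add (differentiable_apply 0)
  have hdiff : DifferentiableOn ℂ (fun ξ : Fin 1 → ℂ => P (c + ξ 0)) (Metric.ball 0 1) :=
    hP.comp hlin.differentiableOn hmaps
  obtain ⟨ξ, hξ, hexp⟩ := ExpDominant.exists_exp_eq_one_add (n := 1) (ε := 1 / 32)
    (fun _ ξ => -P (c + ξ 0)) (by norm_num) (by norm_num) (fun _ => hdiff.neg)
    (fun _ ξ hξ => by rw [norm_neg]; exact hb _ (hmaps hξ))
  refine ⟨c + ξ 0, ?_, ?_⟩
  · rw [add_sub_cancel_left]; exact (norm_le_pi_norm ξ 0).trans hξ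
  · rw [exp_add, hc, one_mul, hexp 0, sub_eq_add_neg]

/-- The lattice points `c_k = 2πi(k+1)`. [folklore] -/
def escCentre (k : ℕ) : ℂ := 2 * Real.pi * ((k : ℝ) + 1) * I

/-- `e^{c_k} = 1`. [folklore] -/
theorem exp_escCentre (k : ℕ) : exp (escCentre k) = 1 := by
  rw [escCentre, show (2 * Real.pi * ((k : ℝ) + 1) * I : ℂ) = ((k + 1 : ℕ) : ℂ) * (2 * Real.pi * I) by
    push_cast; ring]
  exact exp_nat_mul_two_pi_mul_I (k + 1)

/-- `‖c_k‖ = 2π(k+1)`. [folklore] -/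
theorem norm_escCentre (k : ℕ) : ‖escCentre k‖ = 2 * Real.pi * ((k : ℝ) + 1) := by
  rw [escCentre, show (2 * Real.pi * ((k : ℝ) + 1) * I : ℂ) = ((2 * Real.pi * ((k : ℝ) + 1) : ℝ) : ℂ) * I by
    push_cast; ring, norm_mul, norm_I, mul_one, Complex.norm_real, Real.norm_eq_abs,
    abs_of_nonneg (by positivity)]

/-- The key inequality: `-4π²K² + 4πK + 1 ≤ -23K` for `K ≥ 1`. [folklore] -/
theorem quad_bound {K : ℝ} (hK : 1 ≤ K) :
    -4 * Real.pi ^ 2 * K ^ 2 + 4 * Real.pi * K + 1 ≤ -23 * K := by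
  have hπ := Real.pi_gt_three
  have h3 : Real.pi ^ 2 * K - Real.pi - 6 > 0 := by nlinarith
  have h4 : 4 * K * (Real.pi ^ 2 * K - Real.pi - 6) ≥ 0 := by
    have : (0 : ℝ) ≤ 4 * K := by linarith
    exact mul_nonneg this h3.le
  nlinarith

/-- `Re (c_k + t)² ≤ -23 (k+1)` for `‖t‖ ≤ 1`. [folklore] -/
theorem re_sq_escCentre_add_le (k : ℕ) {t : ℂ} (ht : ‖t‖ ≤ 1) :
    ((escCentre k + t) ^ 2).re ≤ -23 * ((k : ℝ) + 1) := by
  have hK : (1 : ℝ) ≤ (k : ℝ) + 1 := by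
    have : (0 : ℝ) ≤ k := Nat.cast_nonneg k
    linarith
  have hsq : (escCentre k) ^ 2 = ((-4 * Real.pi ^ 2 * ((k : ℝ) + 1) ^ 2 : ℝ) : ℂ) := by
    unfold escCentre
    push_cast
    linear_combination (4 * (Real.pi : ℂ) ^ 2 * ((k : ℂ) + 1) ^ 2) * I_sq
  have hexp : (escCentre k + t) ^ 2 = (escCentre k) ^ 2 + (2 * escCentre k * t + t ^ 2) := by ring
  rw [hexp, add_re, hsq, ofReal_re]
  have h1 : (2 * escCentre k * t + t ^ 2).re ≤ ‖2 * escCentre k * t + t ^ 2‖ := re_le_norm _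
  have h2 : ‖2 * escCentre k * t + t ^ 2‖ ≤ 4 * Real.pi * ((k : ℝ) + 1) + 1 := by
    refine (norm_add_le _ _).trans (add_le_add ?_ ?_)
    · rw [norm_mul, norm_mul, norm_escCentre, Complex.norm_two]
      have : 0 ≤ 2 * (2 * Real.pi * ((k : ℝ) + 1)) := by positivity
      calc 2 * (2 * Real.pi * ((k : ℝ) + 1)) * ‖t‖ ≤ 2 * (2 * Real.pi * ((k : ℝ) + 1)) * 1 :=
            mul_le_mul_of_nonneg_left ht this
        _ = 4 * Real.pi * ((k : ℝ) + 1) := by ring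
    · rw [norm_pow]; exact pow_le_one₀ (norm_nonneg _) ht
  have h3 := quad_bound hK
  linarith

/-- `‖e^{(c_k + t)²}‖ ≤ e^{-23(k+1)}` for `‖t‖ ≤ 1`. [folklore] -/
theorem norm_exp_sq_escCentre_add_le (k : ℕ) {t : ℂ} (ht : ‖t‖ ≤ 1) :
    ‖exp ((escCentre k + t) ^ 2)‖ ≤ Real.exp (-23 * ((k : ℝ) + 1)) := by
  rw [norm_exp]
  exact Real.exp_le_exp.2 (re_sq_escCentre_add_le k ht)

/-- `e^{-23} ≤ 1/32`. [folklore] -/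
theorem exp_neg_23_le : Real.exp (-23) ≤ 1 / 32 := by
  have h := Real.add_one_le_exp (23 / 2 : ℝ)
  have h2 : Real.exp 23 = Real.exp (23 / 2) * Real.exp (23 / 2) := by
    rw [← Real.exp_add]; norm_num
  have hpos := Real.exp_pos (23 / 2 : ℝ)
  have h32 : (32 : ℝ) ≤ Real.exp 23 := by rw [h2]; nlinarith
  rw [Real.exp_neg]
  calc (Real.exp 23)⁻¹ ≤ (32 : ℝ)⁻¹ := inv_anti₀ (by norm_num) h32
    _ = 1 / 32 := by norm_num

/-- **Degenerate-escape solutions of `e^z + e^{z²} = 1`**: for every `k` there is `z_k` with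
`‖z_k - 2πi(k+1)‖ ≤ 1/2` and `e^{z_k} = 1 - e^{z_k²}`. [folklore] -/
theorem exists_escapeSeq : ∃ z : ℕ → ℂ, ∀ k, ‖z k - escCentre k‖ ≤ 1 / 2 ∧
    exp (z k) = 1 - exp (z k ^ 2) := by
  have h : ∀ k : ℕ, ∃ z : ℂ, ‖z - escCentre k‖ ≤ 1 / 2 ∧ exp z = 1 - exp (z ^ 2) := by
    intro k
    refine exists_exp_eq_one_sub_of_small (escCentre k) (exp_escCentre k) (fun z => exp (z ^ 2))
      ((differentiable_exp.comp (differentiable_pow 2)).differentiableOn) fun z hz => ?_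
    have ht : ‖z - escCentre k‖ ≤ 1 := by
      rw [Metric.mem_ball, dist_eq_norm] at hz; exact hz.le
    have := norm_exp_sq_escCentre_add_le k ht
    rw [add_sub_cancel] at this
    refine this.trans ((Real.exp_le_exp.2 ?_).trans exp_neg_23_le)
    have : (0 : ℝ) ≤ k := Nat.cast_nonneg k
    linarith
  choose z hz using h
  exact ⟨z, hz⟩

/-- A chosen degenerate-escape sequence. [folklore] -/
def escapeSeq : ℕ → ℂ := Classical.choose exists_escapeSeq

/-- The defining property of `escapeSeq`. [folklore] -/
theorem escapeSeq_spec (k : ℕ) : ‖escapeSeq k - escCentre k‖ ≤ 1 / 2 ∧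
    exp (escapeSeq k) = 1 - exp (escapeSeq k ^ 2) :=
  Classical.choose_spec exists_escapeSeq k

/-- The small partner `w_k = e^{z_k²}`. [folklore] -/
def escapeW (k : ℕ) : ℂ := exp (escapeSeq k ^ 2)

/-- `e^{z_k} = 1 - w_k`. [folklore] -/
theorem exp_escapeSeq (k : ℕ) : exp (escapeSeq k) = 1 - escapeW k := (escapeSeq_spec k).2

/-- `w_k ≠ 0`. [folklore] -/
theorem escapeW_ne_zero (k : ℕ) : escapeW k ≠ 0 := exp_ne_zero _

/-- `‖w_k‖ ≤ e^{-(k+1)}`. [folklore] -/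
theorem norm_escapeW_le (k : ℕ) : ‖escapeW k‖ ≤ Real.exp (-((k : ℝ) + 1)) := by
  have ht : ‖escapeSeq k - escCentre k‖ ≤ 1 := (escapeSeq_spec k).1.trans (by norm_num)
  have := norm_exp_sq_escCentre_add_le k ht
  rw [add_sub_cancel] at this
  refine this.trans (Real.exp_le_exp.2 ?_)
  have : (0 : ℝ) ≤ k := Nat.cast_nonneg k
  linarith

/-- `‖z_k‖ ≤ 7(k+1)`. [folklore] -/
theorem norm_escapeSeq_le (k : ℕ) : ‖escapeSeq k‖ ≤ 7 * ((k : ℝ) + 1) := by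
  have h1 : ‖escapeSeq k‖ ≤ ‖escapeSeq k - escCentre k‖ + ‖escCentre k‖ := by
    have := norm_add_le (escapeSeq k - escCentre k) (escCentre k)
    rwa [sub_add_cancel] at this
  have h2 := (escapeSeq_spec k).1
  rw [norm_escCentre] at h1
  have hπ := Real.pi_lt_d2
  have hk : (0 : ℝ) ≤ k := Nat.cast_nonneg k
  have h3 : (7 - 2 * Real.pi) * 1 ≤ (7 - 2 * Real.pi) * ((k : ℝ) + 1) :=
    mul_le_mul_of_nonneg_left (by linarith) (by linarith)
  linarith

/-- `‖z_k‖ ≥ 2π(k+1) - 1/2`. [folklore] -/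
theorem norm_escCentre_sub_le_norm_escapeSeq (k : ℕ) :
    2 * Real.pi * ((k : ℝ) + 1) - 1 / 2 ≤ ‖escapeSeq k‖ := by
  have h1 : ‖escCentre k‖ ≤ ‖escCentre k - escapeSeq k‖ + ‖escapeSeq k‖ := by
    have := norm_add_le (escCentre k - escapeSeq k) (escapeSeq k)
    rwa [sub_add_cancel] at this
  rw [norm_sub_rev] at h1
  have h2 := (escapeSeq_spec k).1
  rw [norm_escCentre] at h1
  linarith

/-- A sequence bounded below by `a K_k - b` (`a > 0`, `K_k → ∞`) tends to infinity in norm. [folklore] -/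
theorem tendsto_norm_atTop_of_le {K : ℕ → ℝ} (hK : Tendsto K atTop atTop) {z : ℕ → ℂ}
    {a b : ℝ} (ha : 0 < a) (hz : ∀ k, a * K k - b ≤ ‖z k‖) :
    Tendsto (fun k => ‖z k‖) atTop atTop := by
  refine tendsto_atTop_mono hz ?_
  exact tendsto_atTop_add_const_right _ _ (hK.const_mul_atTop ha)

/-- **Exponential decay against linear growth is super-polynomial decay**: `‖z_k‖ ≤ A K_k` and
`‖w_k‖ ≤ e^{-K_k}` with `K_k → ∞` give `‖w_k‖ ‖z_k‖^N → 0` for every `N`. [folklore] -/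
theorem superdecay_of_le {K : ℕ → ℝ} (hK : Tendsto K atTop atTop)
    {z w : ℕ → ℂ} {A : ℝ} (hz : ∀ k, ‖z k‖ ≤ A * K k)
    (hw : ∀ k, ‖w k‖ ≤ Real.exp (-K k)) (N : ℕ) :
    Tendsto (fun k => ‖w k‖ * ‖z k‖ ^ N) atTop (𝓝 0) := by
  have h0 := (Real.tendsto_pow_mul_exp_neg_atTop_nhds_zero N).comp hK
  have h1 : Tendsto (fun k : ℕ => A ^ N * ((K k) ^ N * Real.exp (-K k))) atTop (𝓝 0) := by
    simpa using h0.const_mul (A ^ N)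
  refine squeeze_zero (fun k => by positivity) (fun k => ?_) h1
  calc ‖w k‖ * ‖z k‖ ^ N
      ≤ Real.exp (-K k) * (A * K k) ^ N :=
        mul_le_mul (hw k) (pow_le_pow_left₀ (norm_nonneg _) (hz k) N) (by positivity)
          (Real.exp_nonneg _)
    _ = A ^ N * ((K k) ^ N * Real.exp (-K k)) := by rw [mul_pow]; ring

/-- `k + c → ∞`. [folklore] -/
theorem tendsto_natCast_add_atTop (c : ℝ) : Tendsto (fun k : ℕ => (k : ℝ) + c) atTop atTop :=
  tendsto_atTop_add_const_right _ _ tendsto_natCast_atTop_atTop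

/-- `‖z_k‖ → ∞`. [folklore] -/
theorem tendsto_norm_escapeSeq : Tendsto (fun k => ‖escapeSeq k‖) atTop atTop :=
  tendsto_norm_atTop_of_le (tendsto_natCast_add_atTop 1) (b := 1 / 2) (by positivity)
    norm_escCentre_sub_le_norm_escapeSeq

/-- **Super-polynomial decay**: `‖w_k‖ ‖z_k‖^N → 0` for every `N`. [folklore] -/
theorem tendsto_escapeW_mul_pow (N : ℕ) :
    Tendsto (fun k => ‖escapeW k‖ * ‖escapeSeq k‖ ^ N) atTop (𝓝 0) :=
  superdecay_of_le (tendsto_natCast_add_atTop 1) norm_escapeSeq_le norm_escapeW_le N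

end Escape

/-! ### C. Mantova–Masser's example with a parabola: density of the exponential points -/

section Parabola

open Complex Literature.ModelTheory.ExponentialFields

/-- **`S_par = {x₁ = x₀², y₀ + y₁ = 1} ⊆ ℂ² × ℂ²`** — Mantova–Masser's example (fermat)
[MantovaMasser2023, §1 (1.5) p. 5: `X₁⁹ + X₂⁹ = 1, X̂₁ + X̂₂ = 1`] with the Fermat nonic replaced
by the parabola; as a graph-fibre variety `W(x₀²; 1 - u)`. Its exponential points are the
solutions of `e^z + e^{z²} = 1`. [cite: MantovaMasser2023, §1 p. 5 (Further remarks)] -/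
def mmParabola : Set (Fin 2 ⊕ Fin 2 → ℂ) :=
  graphFibreVariety (X 0 ^ 2 : MvPolynomial (Fin 1) ℂ) ![1 - X 0]

/-- Membership in `S_par`. [folklore] -/
theorem mem_mmParabola_iff (z : Fin 2 ⊕ Fin 2 → ℂ) :
    z ∈ mmParabola ↔ z (Sum.inl 1) = z (Sum.inl 0) ^ 2 ∧ z (Sum.inr 0) = 1 - z (Sum.inr 1) := by
  rw [mmParabola, mem_graphFibreVariety_iff, Fin.forall_fin_one]
  simp only [map_pow, eval_X, Matrix.cons_val_zero, map_sub, map_one, Fin.cons_zero,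
    Fin.castSucc_zero]
  exact Iff.rfl

/-- The parametrisation `(u, w) ↦ (u, u², 1 - w, w)` of `S_par`. [folklore] -/
def mmParam (u w : ℂ) : Fin 2 ⊕ Fin 2 → ℂ := Sum.elim ![u, u ^ 2] ![1 - w, w]

/-- Coordinate `x₀` of `mmParam`. [folklore] -/
@[simp] theorem mmParam_inl_zero (u w : ℂ) : mmParam u w (Sum.inl 0) = u := rfl
/-- Coordinate `x₁` of `mmParam`. [folklore] -/
@[simp] theorem mmParam_inl_one (u w : ℂ) : mmParam u w (Sum.inl 1) = u ^ 2 := rfl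
/-- Coordinate `y₀` of `mmParam`. [folklore] -/
@[simp] theorem mmParam_inr_zero (u w : ℂ) : mmParam u w (Sum.inr 0) = 1 - w := rfl
/-- Coordinate `y₁` of `mmParam`. [folklore] -/
@[simp] theorem mmParam_inr_one (u w : ℂ) : mmParam u w (Sum.inr 1) = w := rfl

/-- `mmParam u w ∈ S_par`. [folklore] -/
theorem mmParam_mem (u w : ℂ) : mmParam u w ∈ mmParabola := by
  rw [mem_mmParabola_iff]; exact ⟨rfl, rfl⟩

/-- Every point of `S_par` is an `mmParam`. [folklore] -/
theorem eq_mmParam_of_mem {s : Fin 2 ⊕ Fin 2 → ℂ} (hs : s ∈ mmParabola) :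
    s = mmParam (s (Sum.inl 0)) (s (Sum.inr 1)) := by
  rw [mem_mmParabola_iff] at hs
  funext i
  rcases i with i | i <;> fin_cases i
  · rfl
  · exact hs.1
  · exact hs.2
  · rfl

/-- The exponential points of `S_par` with first coordinate `z` are exactly `(z, z², e^z, e^{z²})`
with `e^z + e^{z²} = 1`. [folklore] -/
theorem mmParam_mem_expGraph {u w : ℂ} (hw : w = exp (u ^ 2)) (hu : exp u = 1 - w) :
    mmParam u w ∈ expGraph ℂ 2 := by
  rw [mem_expGraph_iff]
  intro i
  fin_cases i
  · simp [ExponentialRing.complex_exp_eq, hu]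
  · simp [ExponentialRing.complex_exp_eq, hw]

/-- The symbolic parametrisation: `x₀ ↦ z`, `x₁ ↦ z²`, `y₀ ↦ 1 - w`, `y₁ ↦ w` in `ℂ[z][w]`. [folklore] -/
def mmSymb : Fin 2 ⊕ Fin 2 → Polynomial (Polynomial ℂ) :=
  Sum.elim ![Polynomial.C Polynomial.X, Polynomial.C (Polynomial.X ^ 2)]
    ![1 - Polynomial.X, Polynomial.X]

/-- Pull-back of `F ∈ ℂ[x₀, x₁, y₀, y₁]` to `ℂ[z][w]` along the parametrisation. [folklore] -/
def mmPullback (F : MvPolynomial (Fin 2 ⊕ Fin 2) ℂ) : Polynomial (Polynomial ℂ) :=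
  eval₂Hom (Polynomial.C.comp Polynomial.C) mmSymb F

/-- Evaluation of `ℂ[z][w]` at `(u, w)`. [folklore] -/
def mmEval (u w : ℂ) : Polynomial (Polynomial ℂ) →+* ℂ :=
  Polynomial.eval₂RingHom (Polynomial.evalRingHom u) w

/-- `mmEval u w` sends the inner variable to `u`. [folklore] -/
@[simp] theorem mmEval_C_X (u w : ℂ) : mmEval u w (Polynomial.C Polynomial.X) = u := by
  simp [mmEval]

/-- `mmEval u w` sends the outer variable to `w`. [folklore] -/
@[simp] theorem mmEval_X (u w : ℂ) : mmEval u w Polynomial.X = w := by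
  simp [mmEval]

/-- `mmEval u w` is the identity on constants. [folklore] -/
theorem mmEval_comp_C (u w : ℂ) :
    (mmEval u w).comp (Polynomial.C.comp Polynomial.C) = RingHom.id ℂ := by
  ext c
  simp [mmEval]

/-- `mmEval u w` on the symbols `mmSymb` gives the coordinates of `mmParam u w`. [folklore] -/
theorem mmEval_mmSymb (u w : ℂ) : (fun i => mmEval u w (mmSymb i)) = mmParam u w := by
  funext i
  rcases i with i | i <;> fin_cases i <;> simp [mmSymb, mmParam]

/-- **The pull-back evaluates to `F` on the parametrised point.** [folklore] -/
theorem mmEval_mmPullback (F : MvPolynomial (Fin 2 ⊕ Fin 2) ℂ) (u w : ℂ) :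
    mmEval u w (mmPullback F) = MvPolynomial.eval (mmParam u w) F := by
  rw [mmPullback, ← RingHom.comp_apply, MvPolynomial.comp_eval₂Hom, mmEval_comp_C,
    mmEval_mmSymb]
  rfl

/-- `mmEval` unfolded. [folklore] -/
theorem mmEval_eq_eval₂ (u w : ℂ) (G : Polynomial (Polynomial ℂ)) :
    mmEval u w G = G.eval₂ (Polynomial.evalRingHom u) w := rfl

/-- **Density theorem for `S_par`** (an affirmative instance of Mantova–Masser's question
[MantovaMasser2023, §1 p. 5, Further remarks] in their open case (dim-pi-S-1-free)): the
exponential points of `S_par = {x₁ = x₀², y₀ + y₁ = 1}` are Zariski dense, `I(S_par ∩ Γ_exp) =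
I(S_par)`. Proof: the degenerate-escape solutions `z_k ≈ 2πi(k+1)` of `e^z = 1 - e^{z²}` have
`w_k = e^{z_k²}` super-polynomially small; a polynomial vanishing at all `(z_k, z_k², 1 - w_k, w_k)`
pulls back to `G ∈ ℂ[z][w]` with `G(z_k, w_k) = 0`, so `G = 0` by the elimination lemma, i.e. it
vanishes on all of `S_par`. (new in this file) [folklore] -/
theorem vanishingIdeal_mmParabola_inter_expGraph :
    vanishingIdeal ℂ (mmParabola ∩ expGraph ℂ 2) = vanishingIdeal ℂ mmParabola := by
  refine le_antisymm ?_ (vanishingIdeal_anti_mono Set.inter_subset_left)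
  intro F hF
  have hG0 : mmPullback F = 0 := by
    refine eq_zero_of_eval₂_eq_zero_of_superdecay (mmPullback F) escapeSeq escapeW
      tendsto_norm_escapeSeq escapeW_ne_zero tendsto_escapeW_mul_pow fun k => ?_
    rw [← mmEval_eq_eval₂, mmEval_mmPullback, ← coe_aeval_eq_eval]
    exact (mem_vanishingIdeal_iff.mp hF) _
      ⟨mmParam_mem _ _, mmParam_mem_expGraph rfl (exp_escapeSeq k)⟩
  rw [mem_vanishingIdeal_iff]
  intro s hs
  have h := mmEval_mmPullback F (s (Sum.inl 0)) (s (Sum.inr 1))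
  rw [hG0, map_zero, ← eq_mmParam_of_mem hs] at h
  simpa [coe_aeval_eq_eval] using h.symm

/-- Equivalently: the Zariski closure of the exponential points of `S_par` is `S_par`. [folklore] -/
theorem zeroLocus_vanishingIdeal_mmParabola_inter_expGraph :
    zeroLocus ℂ (vanishingIdeal ℂ (mmParabola ∩ expGraph ℂ 2)) = mmParabola := by
  rw [vanishingIdeal_mmParabola_inter_expGraph, mmParabola, graphFibreVariety_eq_polyFibredGraph]
  exact (eq_zeroLocus_vanishingIdeal_of_isZariskiClosed
    (isIrreducibleClosed_polyFibredGraph _ _ _).1).symm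

/-- The symbolic substitution `X₁ ↦ z`, `X̂₁ ↦ 1 - w` in `ℂ[z][w]`. [folklore] -/
def mmSymb₁ : Fin 2 → Polynomial (Polynomial ℂ) :=
  ![Polynomial.C Polynomial.X, 1 - Polynomial.X]

/-- Evaluating the pullback along `mmSymb₁` is evaluating at `(u, 1 - w)`. [folklore] -/
theorem mmEval_pullback₁ (G : MvPolynomial (Fin 2) ℂ) (u w : ℂ) :
    mmEval u w (eval₂Hom (Polynomial.C.comp Polynomial.C) mmSymb₁ G) =
      MvPolynomial.eval ![u, 1 - w] G := by
  rw [← RingHom.comp_apply, MvPolynomial.comp_eval₂Hom, mmEval_comp_C]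
  have : (fun i => mmEval u w (mmSymb₁ i)) = ![u, 1 - w] := by
    funext i
    fin_cases i <;> simp [mmSymb₁]
  rw [this]
  rfl

/-- **Mantova–Masser's formulation** [MantovaMasser2023, §1 p. 5: "the density in `S` would
amount to the fact that there is no `G ≠ 0` in `ℂ[X₁, X̂₁]` such that `G(z, e^z) = 0` for all `z`
with `e^z + e^{⁹√(1-z⁹)} = 1`, which does not seem obvious"], decided for the parabola in place
of the Fermat nonic: there is no `G ≠ 0` in `ℂ[X₁, X̂₁]` with `G(z, e^z) = 0` for all `z` with
`e^z + e^{z²} = 1`. (new in this file) [folklore] -/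
theorem eq_zero_of_forall_exp_add_exp_sq_eq_one (G : MvPolynomial (Fin 2) ℂ)
    (hG : ∀ z : ℂ, exp z + exp (z ^ 2) = 1 → MvPolynomial.eval ![z, exp z] G = 0) : G = 0 := by
  have hG' : eval₂Hom (Polynomial.C.comp Polynomial.C) mmSymb₁ G = 0 := by
    refine eq_zero_of_eval₂_eq_zero_of_superdecay _ escapeSeq escapeW
      tendsto_norm_escapeSeq escapeW_ne_zero tendsto_escapeW_mul_pow fun k => ?_
    rw [← mmEval_eq_eval₂, mmEval_pullback₁, ← exp_escapeSeq k]
    refine hG _ ?_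
    rw [exp_escapeSeq, escapeW]
    ring
  apply MvPolynomial.funext
  intro x
  rw [map_zero]
  have h := mmEval_pullback₁ G (x 0) (1 - x 1)
  rw [hG', map_zero, sub_sub_cancel] at h
  have hx : ![x 0, x 1] = x := by
    funext i
    fin_cases i <;> rfl
  rw [← hx]
  exact h.symm

/-! #### `S_par` lies in Mantova–Masser's open case (dim-pi-S-1-free) -/

/-- `S_par` is irreducible Zariski closed. [folklore] -/
theorem isIrreducibleClosed_mmParabola : IsIrreducibleClosed ℂ mmParabola := by
  rw [mmParabola, graphFibreVariety_eq_polyFibredGraph]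
  exact isIrreducibleClosed_polyFibredGraph _ _ _

/-- `dim S_par = 2`. [folklore] -/
theorem zariskiDim_mmParabola : zariskiDim ℂ mmParabola = (2 : ℕ) := by
  rw [mmParabola, graphFibreVariety_eq_polyFibredGraph]
  exact zariskiDim_polyFibredGraph _ _ _

/-- The torus part of `S_par` is non-empty. [folklore] -/
theorem mmParabola_inter_torusLocus_nonempty : (mmParabola ∩ torusLocus ℂ 2).Nonempty := by
  refine ⟨mmParam 0 2, mmParam_mem 0 2, ?_⟩
  rw [mem_torusLocus_iff]
  intro i; fin_cases i <;> norm_num [mmParam]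

/-- `π(S_par ∩ G²)` is the whole parabola `{x₁ = x₀²}`. [folklore] -/
theorem projAdd_image_mmParabola_inter_torusLocus :
    projAdd '' (mmParabola ∩ torusLocus ℂ 2) = graphBase (X 0 ^ 2 : MvPolynomial (Fin 1) ℂ) := by
  ext x
  simp only [Set.mem_image, Set.mem_inter_iff, graphBase, Set.mem_setOf_eq, map_pow, eval_X]
  constructor
  · rintro ⟨z, ⟨hz, -⟩, rfl⟩
    rw [mem_mmParabola_iff] at hz
    simpa using hz.1
  · intro hx
    refine ⟨mmParam (x 0) 2, ⟨mmParam_mem _ _, ?_⟩, ?_⟩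
    · rw [mem_torusLocus_iff]; intro i; fin_cases i <;> norm_num [mmParam]
    · funext i
      fin_cases i
      · rfl
      · simpa using hx.symm

/-- `dim cl π(S_par ∩ G²) = 1` (the closure is the parabola). [folklore] -/
theorem addProjDim_mmParabola : addProjDim ℂ 2 mmParabola = (1 : ℕ) := by
  unfold addProjDim zariskiDim
  rw [projAdd_image_mmParabola_inter_torusLocus, vanishingIdeal_graphBase,
    ringKrullDim_eq_of_ringEquiv
      (Ideal.quotientKerAlgEquivOfSurjective (graphSubst_surjective _)).toRingEquiv,
    MvPolynomial.ringKrullDim_of_isNoetherianRing, ringKrullDim_eq_zero_of_field,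
    Nat.card_eq_fintype_card, Fintype.card_fin, zero_add]

/-- The closure of `π(S_par ∩ G²)` is not a line of rational slope (it contains `(0,0)`, `(1,1)`,
`(-1,1)`). [folklore] -/
theorem not_isRationalSlopeLine_mmParabola :
    ¬ IsRationalSlopeLine (zeroLocus ℂ (vanishingIdeal ℂ
      (projAdd '' (mmParabola ∩ torusLocus ℂ 2)))) := by
  rw [projAdd_image_mmParabola_inter_torusLocus]
  rintro ⟨m, hm, c, hL⟩
  have hsub : ∀ x : Fin 2 → ℂ, x 1 = x 0 ^ 2 → (m 0 : ℂ) * x 0 + (m 1 : ℂ) * x 1 = c := by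
    intro x hx
    have hxB : x ∈ graphBase (X 0 ^ 2 : MvPolynomial (Fin 1) ℂ) := by
      simp only [graphBase, Set.mem_setOf_eq, map_pow, eval_X]; simpa using hx
    have hxZ : x ∈ zeroLocus ℂ (vanishingIdeal ℂ (graphBase (X 0 ^ 2 : MvPolynomial (Fin 1) ℂ))) := by
      rw [mem_zeroLocus_iff]
      intro p hp
      exact (mem_vanishingIdeal_iff.mp hp) x hxB
    rw [hL] at hxZ
    exact hxZ
  have h0 := hsub ![0, 0] (by simp)
  have h1 := hsub ![1, 1] (by simp)
  have h2 := hsub ![-1, 1] (by simp)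
  simp only [Matrix.cons_val_zero, Matrix.cons_val_one] at h0 h1 h2
  have hm0 : (m 0 : ℂ) = 0 := by linear_combination (h1 - h2) / 2
  have hm1 : (m 1 : ℂ) = 0 := by linear_combination (h1 + h2) / 2 - h0
  apply hm
  funext i
  fin_cases i
  · exact_mod_cast hm0
  · exact_mod_cast hm1

end Parabola

/-! ### D. Mantova–Masser's literal example (fermat): `e^z + e^{⁹√(1 - z⁹)} = 1` -/

section Fermat

open Complex

/-- `η = e^{iπ/3}` (so `η⁹ = -1` and `Re(η i) = -√3/2`): the direction of the ninth-root branch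
with very negative real part. [folklore] -/
def eta : ℂ := exp (((Real.pi / 3 : ℝ) : ℂ) * I)

/-- `‖η‖ = 1`. [folklore] -/
theorem norm_eta : ‖eta‖ = 1 := norm_exp_ofReal_mul_I _

/-- `η⁹ = -1`. [folklore] -/
theorem eta_pow_nine : eta ^ 9 = -1 := by
  rw [eta, ← Complex.exp_nat_mul]
  have : ((9 : ℕ) : ℂ) * (((Real.pi / 3 : ℝ) : ℂ) * I) =
      Real.pi * I + ((1 : ℕ) : ℂ) * (2 * Real.pi * I) := by
    push_cast; ring
  rw [this, Complex.exp_add, exp_pi_mul_I, exp_nat_mul_two_pi_mul_I]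
  norm_num

/-- `η = 1/2 + (√3/2) i`. [folklore] -/
theorem eta_eq : eta = ((1 / 2 : ℝ) : ℂ) + ((Real.sqrt 3 / 2 : ℝ) : ℂ) * I := by
  rw [eta, exp_mul_I, ← ofReal_cos, ← ofReal_sin, Real.cos_pi_div_three, Real.sin_pi_div_three]

/-- `Re(η · ir) = -(√3/2) r` for real `r`. [folklore] -/
theorem re_eta_mul_real_mul_I (r : ℝ) : (eta * ((r : ℂ) * I)).re = -(Real.sqrt 3 / 2) * r := by
  rw [eta_eq]
  simp [Complex.mul_re, Complex.mul_im]

/-- `v(z) = -z⁻⁹`, `ρ(z) = (1 + v(z))^{1/9}` (principal), and the branch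
`x₂(z) = η z ρ(z)` of `x₂⁹ = 1 - z⁹`. [folklore] -/
def fermatV (z : ℂ) : ℂ := -(z ^ 9)⁻¹

/-- See `fermatV`. [folklore] -/
def fermatRho (z : ℂ) : ℂ := exp (log (1 + fermatV z) / 9)

/-- **The ninth-root branch** `x₂(z) = η z (1 - z⁻⁹)^{1/9}`, holomorphic for `|z| > 1`, with
`x₂(z)⁹ = 1 - z⁹` and `Re x₂(z) ≈ -√3 π k` near `z = 2πik`. [folklore] -/
def fermatBranch (z : ℂ) : ℂ := eta * z * fermatRho z

/-- `x₂(z)⁹ = 1 - z⁹` wherever the branch is defined (`z ≠ 0`, `1 - z⁻⁹ ≠ 0`). [folklore] -/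
theorem fermatBranch_pow_nine {z : ℂ} (hz : z ≠ 0) (hv : 1 + fermatV z ≠ 0) :
    fermatBranch z ^ 9 = 1 - z ^ 9 := by
  have h9 : z ^ 9 ≠ 0 := pow_ne_zero 9 hz
  have hρ : fermatRho z ^ 9 = 1 + fermatV z := by
    rw [fermatRho, ← Complex.exp_nat_mul]
    push_cast
    rw [mul_div_cancel₀ _ (by norm_num : (9 : ℂ) ≠ 0), exp_log hv]
  rw [fermatBranch, mul_pow, mul_pow, eta_pow_nine, hρ, fermatV]
  field_simp
  ring

/-- The branch `x₂` is holomorphic where `‖z⁻⁹‖ < 1`. [folklore] -/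
theorem differentiableAt_fermatBranch {z : ℂ} (hz : z ≠ 0) (hv : ‖fermatV z‖ < 1) :
    DifferentiableAt ℂ fermatBranch z := by
  have hp : DifferentiableAt ℂ (fun t : ℂ => t ^ 9) z := differentiableAt_pow 9
  have h1 : DifferentiableAt ℂ fermatV z := by
    unfold fermatV
    exact (hp.inv (pow_ne_zero 9 hz)).neg
  have h2 : DifferentiableAt ℂ (fun t => log (1 + fermatV t)) z :=
    ((differentiableAt_const (1 : ℂ)).add h1).clog (mem_slitPlane_of_norm_lt_one hv)
  have h3 : DifferentiableAt ℂ fermatRho z := by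
    unfold fermatRho
    exact (h2.div_const 9).cexp
  unfold fermatBranch
  exact ((differentiableAt_const eta).mul differentiableAt_id).mul h3

/-- Points of the unit disc around `2πi(k+2)`: `‖z‖ ≥ 11`. [folklore] -/
theorem norm_ge_of_near_escCentre_succ (k : ℕ) {z : ℂ} (hz : ‖z - escCentre (k + 1)‖ ≤ 1) :
    2 * Real.pi * ((k : ℝ) + 2) - 1 ≤ ‖z‖ ∧ (11 : ℝ) ≤ ‖z‖ := by
  have h1 : ‖escCentre (k + 1)‖ ≤ ‖escCentre (k + 1) - z‖ + ‖z‖ := by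
    have := norm_add_le (escCentre (k + 1) - z) z
    rwa [sub_add_cancel] at this
  rw [norm_sub_rev, norm_escCentre] at h1
  push_cast at h1
  have hπ := Real.pi_gt_three
  have hk : (0 : ℝ) ≤ k := Nat.cast_nonneg k
  constructor
  · linarith
  · nlinarith

/-- For `‖z‖ ≥ 11`: `‖v(z)‖ ≤ 1/2` and `‖z‖ ‖v(z)‖ ≤ 1`. [folklore] -/
theorem norm_fermatV_le {z : ℂ} (hz : (11 : ℝ) ≤ ‖z‖) :
    ‖fermatV z‖ ≤ 1 / 2 ∧ ‖z‖ * ‖fermatV z‖ ≤ 1 := by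
  have hz1 : (1 : ℝ) ≤ ‖z‖ := by linarith
  have hz0 : 0 < ‖z‖ := by linarith
  rw [fermatV, norm_neg, norm_inv, norm_pow]
  constructor
  · rw [inv_le_comm₀ (by positivity) (by norm_num)]
    calc ((1 : ℝ) / 2)⁻¹ = 2 := by norm_num
      _ ≤ ‖z‖ := by linarith
      _ ≤ ‖z‖ ^ 9 := le_self_pow₀ hz1 (by norm_num)
  · rw [show ‖z‖ ^ 9 = ‖z‖ * ‖z‖ ^ 8 by ring, mul_inv, ← mul_assoc, mul_inv_cancel₀ hz0.ne',
      one_mul]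
    exact inv_le_one_of_one_le₀ (one_le_pow₀ hz1)

/-- **The real part of the branch**: `Re x₂(z) ≤ -4(k+2)` on the unit disc around `2πi(k+2)`. [folklore] -/
theorem re_fermatBranch_le (k : ℕ) {z : ℂ} (hz : ‖z - escCentre (k + 1)‖ ≤ 1) :
    (fermatBranch z).re ≤ -4 * ((k : ℝ) + 2) := by
  obtain ⟨hzl, hz11⟩ := norm_ge_of_near_escCentre_succ k hz
  obtain ⟨hv, hzv⟩ := norm_fermatV_le hz11
  -- `ρ - 1` is small
  have hlog : ‖log (1 + fermatV z)‖ ≤ 3 / 2 * ‖fermatV z‖ := norm_log_one_add_half_le_self hv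
  have hlog9 : ‖log (1 + fermatV z) / 9‖ ≤ 1 := by
    rw [norm_div, RCLike.norm_ofNat]
    linarith [norm_nonneg (fermatV z)]
  have hρ : ‖fermatRho z - 1‖ ≤ ‖fermatV z‖ / 3 := by
    rw [fermatRho]
    refine (norm_exp_sub_one_le hlog9).trans ?_
    rw [norm_div, RCLike.norm_ofNat]
    linarith
  -- decomposition `x₂ = η c + η (z - c) + η z (ρ - 1)`
  have hdec : fermatBranch z = eta * escCentre (k + 1) + eta * (z - escCentre (k + 1)) +
      eta * z * (fermatRho z - 1) := by
    rw [fermatBranch]; ring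
  have hc : eta * escCentre (k + 1) = eta * (((2 * Real.pi * ((k : ℝ) + 2) : ℝ) : ℂ) * I) := by
    rw [escCentre]; push_cast; ring
  have hre1 : (eta * escCentre (k + 1)).re = -(Real.sqrt 3 / 2) * (2 * Real.pi * ((k : ℝ) + 2)) := by
    rw [hc, re_eta_mul_real_mul_I]
  have hre2 : (eta * (z - escCentre (k + 1))).re ≤ 1 := by
    refine (re_le_norm _).trans ?_
    rw [norm_mul, norm_eta, one_mul]; exact hz
  have hre3 : (eta * z * (fermatRho z - 1)).re ≤ 1 / 3 := by
    refine (re_le_norm _).trans ?_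
    rw [norm_mul, norm_mul, norm_eta, one_mul]
    calc ‖z‖ * ‖fermatRho z - 1‖ ≤ ‖z‖ * (‖fermatV z‖ / 3) :=
          mul_le_mul_of_nonneg_left hρ (norm_nonneg _)
      _ = ‖z‖ * ‖fermatV z‖ / 3 := by ring
      _ ≤ 1 / 3 := by linarith
  rw [hdec, add_re, add_re, hre1]
  have h17 : (1.7 : ℝ) < Real.sqrt 3 := by
    rw [Real.lt_sqrt (by norm_num)]; norm_num
  have hπ := Real.pi_gt_d2
  have hk : (0 : ℝ) ≤ k := Nat.cast_nonneg k
  have hsp : 5.3 ≤ Real.sqrt 3 * Real.pi := by nlinarith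
  nlinarith

/-- `e^{-8} ≤ 1/32`. [folklore] -/
theorem exp_neg_eight_le : Real.exp (-8) ≤ 1 / 32 := by
  have h := Real.add_one_le_exp (2 : ℝ)
  have h2 : Real.exp 8 = Real.exp 2 ^ 4 := by
    rw [← Real.exp_nat_mul]; norm_num
  have h32 : (32 : ℝ) ≤ Real.exp 8 := by
    have h4 : ((2 : ℝ) + 1) ^ 4 ≤ Real.exp 2 ^ 4 := pow_le_pow_left₀ (by norm_num) h 4
    rw [h2]
    norm_num at h4
    linarith
  rw [Real.exp_neg]
  calc (Real.exp 8)⁻¹ ≤ (32 : ℝ)⁻¹ := inv_anti₀ (by norm_num) h32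
    _ = 1 / 32 := by norm_num

/-- Consequences on the unit disc around `2πi(k+2)`: `z ≠ 0`, `‖v‖ < 1`, `1 + v ≠ 0`,
`‖e^{x₂(z)}‖ ≤ e^{-4(k+2)}`. [folklore] -/
theorem fermat_disc_facts (k : ℕ) {z : ℂ} (hz : ‖z - escCentre (k + 1)‖ ≤ 1) :
    z ≠ 0 ∧ ‖fermatV z‖ < 1 ∧ 1 + fermatV z ≠ 0 ∧
      ‖exp (fermatBranch z)‖ ≤ Real.exp (-4 * ((k : ℝ) + 2)) := by
  obtain ⟨-, hz11⟩ := norm_ge_of_near_escCentre_succ k hz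
  obtain ⟨hv, -⟩ := norm_fermatV_le hz11
  refine ⟨?_, by linarith, ?_, ?_⟩
  · rw [← norm_pos_iff]; linarith
  · intro h
    have : fermatV z = -1 := by linear_combination h
    rw [this, norm_neg, norm_one] at hv
    norm_num at hv
  · rw [norm_exp]; exact Real.exp_le_exp.2 (re_fermatBranch_le k hz)

/-- **Degenerate-escape solutions of `e^z + e^{⁹√(1-z⁹)} = 1`** on the branch `x₂`: for every
`k` a solution within `1/2` of `2πi(k+2)`. [folklore] -/
theorem exists_fermatSeq : ∃ z : ℕ → ℂ, ∀ k, ‖z k - escCentre (k + 1)‖ ≤ 1 / 2 ∧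
    exp (z k) = 1 - exp (fermatBranch (z k)) := by
  have h : ∀ k : ℕ, ∃ z : ℂ, ‖z - escCentre (k + 1)‖ ≤ 1 / 2 ∧
      exp z = 1 - exp (fermatBranch z) := by
    intro k
    refine exists_exp_eq_one_sub_of_small (escCentre (k + 1)) (exp_escCentre (k + 1))
      (fun z => exp (fermatBranch z)) (fun z hz => ?_) fun z hz => ?_
    · have hz' : ‖z - escCentre (k + 1)‖ ≤ 1 := by
        rw [Metric.mem_ball, dist_eq_norm] at hz; exact hz.le
      obtain ⟨hz0, hv, -, -⟩ := fermat_disc_facts k hz'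
      exact (differentiableAt_fermatBranch hz0 hv).cexp.differentiableWithinAt
    · have hz' : ‖z - escCentre (k + 1)‖ ≤ 1 := by
        rw [Metric.mem_ball, dist_eq_norm] at hz; exact hz.le
      refine (fermat_disc_facts k hz').2.2.2.trans ((Real.exp_le_exp.2 ?_).trans exp_neg_eight_le)
      have : (0 : ℝ) ≤ k := Nat.cast_nonneg k
      linarith
  choose z hz using h
  exact ⟨z, hz⟩

/-- A chosen degenerate-escape sequence for the Fermat example. [folklore] -/
def fermatSeq : ℕ → ℂ := Classical.choose exists_fermatSeq

/-- The defining property of `fermatSeq`. [folklore] -/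
theorem fermatSeq_spec (k : ℕ) : ‖fermatSeq k - escCentre (k + 1)‖ ≤ 1 / 2 ∧
    exp (fermatSeq k) = 1 - exp (fermatBranch (fermatSeq k)) :=
  Classical.choose_spec exists_fermatSeq k

/-- `w_k = e^{x₂(z_k)}`. [folklore] -/
def fermatW (k : ℕ) : ℂ := exp (fermatBranch (fermatSeq k))

/-- `z_k` lies in the closed unit disc around `2πi(k+2)`. [folklore] -/
theorem fermatSeq_near (k : ℕ) : ‖fermatSeq k - escCentre (k + 1)‖ ≤ 1 :=
  (fermatSeq_spec k).1.trans (by norm_num)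

/-- `e^{z_k} = 1 - w_k`. [folklore] -/
theorem exp_fermatSeq (k : ℕ) : exp (fermatSeq k) = 1 - fermatW k := (fermatSeq_spec k).2

/-- `w_k ≠ 0`. [folklore] -/
theorem fermatW_ne_zero (k : ℕ) : fermatW k ≠ 0 := exp_ne_zero _

/-- `z_k⁹ + x₂(z_k)⁹ = 1`: the points lie over the Fermat nonic. [folklore] -/
theorem fermatSeq_pow_add_pow (k : ℕ) : fermatSeq k ^ 9 + fermatBranch (fermatSeq k) ^ 9 = 1 := by
  obtain ⟨hz0, -, hv1, -⟩ := fermat_disc_facts k (fermatSeq_near k)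
  rw [fermatBranch_pow_nine hz0 hv1]; ring

/-- `‖w_k‖ ≤ e^{-(k+2)}`. [folklore] -/
theorem norm_fermatW_le (k : ℕ) : ‖fermatW k‖ ≤ Real.exp (-((k : ℝ) + 2)) := by
  refine (fermat_disc_facts k (fermatSeq_near k)).2.2.2.trans (Real.exp_le_exp.2 ?_)
  have : (0 : ℝ) ≤ k := Nat.cast_nonneg k
  linarith

/-- `‖z_k‖ ≤ 7(k+2)`. [folklore] -/
theorem norm_fermatSeq_le (k : ℕ) : ‖fermatSeq k‖ ≤ 7 * ((k : ℝ) + 2) := by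
  have h1 : ‖fermatSeq k‖ ≤ ‖fermatSeq k - escCentre (k + 1)‖ + ‖escCentre (k + 1)‖ := by
    have := norm_add_le (fermatSeq k - escCentre (k + 1)) (escCentre (k + 1))
    rwa [sub_add_cancel] at this
  have h2 := (fermatSeq_spec k).1
  rw [norm_escCentre] at h1
  push_cast at h1
  have hπ := Real.pi_lt_d2
  have hk : (0 : ℝ) ≤ k := Nat.cast_nonneg k
  have h3 : (7 - 2 * Real.pi) * 2 ≤ (7 - 2 * Real.pi) * ((k : ℝ) + 2) :=
    mul_le_mul_of_nonneg_left (by linarith) (by linarith)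
  linarith

/-- `‖z_k‖ ≥ 2π(k+2) - 1`. [folklore] -/
theorem norm_fermatSeq_ge (k : ℕ) : 2 * Real.pi * ((k : ℝ) + 2) - 1 ≤ ‖fermatSeq k‖ :=
  (norm_ge_of_near_escCentre_succ k (fermatSeq_near k)).1

/-- `‖z_k‖ → ∞`. [folklore] -/
theorem tendsto_norm_fermatSeq : Tendsto (fun k => ‖fermatSeq k‖) atTop atTop :=
  tendsto_norm_atTop_of_le (tendsto_natCast_add_atTop 2) (b := 1) (by positivity)
    norm_fermatSeq_ge

/-- `‖w_k‖ ‖z_k‖^N → 0` for every `N`. [folklore] -/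
theorem tendsto_fermatW_mul_pow (N : ℕ) :
    Tendsto (fun k => ‖fermatW k‖ * ‖fermatSeq k‖ ^ N) atTop (𝓝 0) :=
  superdecay_of_le (tendsto_natCast_add_atTop 2) norm_fermatSeq_le norm_fermatW_le N

/-- **Mantova–Masser's sentence for their example (fermat), decided** [MantovaMasser2023, §1 p. 5,
Further remarks: "Just for the example (1.5) the density in `S` would amount to the fact that
there is no `G ≠ 0` in `ℂ[X₁, X̂₁]` such that `G(z, e^z) = 0` for all `z` with
`e^z + e^{⁹√(1-z⁹)} = 1`, which does not seem obvious."]: indeed there is no such `G`. Here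
"`z` with `e^z + e^{⁹√(1-z⁹)} = 1`" is read as: some ninth root `s` of `1 - z⁹` has
`e^z + e^s = 1` (their multivalued notation). Proof: the degenerate-escape solutions `z_k ≈ 2πi(k+2)`
on the branch `x₂ = η z (1 - z⁻⁹)^{1/9}` (`Re x₂ ≤ -4(k+2)`) and the elimination lemma.
(new in this file) [folklore] -/
theorem mantovaMasser_fermat_noRelation (G : MvPolynomial (Fin 2) ℂ)
    (hG : ∀ z s : ℂ, z ^ 9 + s ^ 9 = 1 → exp z + exp s = 1 →
      MvPolynomial.eval ![z, exp z] G = 0) : G = 0 := by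
  have hG' : eval₂Hom (Polynomial.C.comp Polynomial.C) mmSymb₁ G = 0 := by
    refine eq_zero_of_eval₂_eq_zero_of_superdecay _ fermatSeq fermatW
      tendsto_norm_fermatSeq fermatW_ne_zero tendsto_fermatW_mul_pow fun k => ?_
    rw [← mmEval_eq_eval₂, mmEval_pullback₁, ← exp_fermatSeq k]
    refine hG _ (fermatBranch (fermatSeq k)) (fermatSeq_pow_add_pow k) ?_
    rw [exp_fermatSeq, fermatW]
    ring
  apply MvPolynomial.funext
  intro x
  rw [map_zero]
  have h := mmEval_pullback₁ G (x 0) (1 - x 1)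
  rw [hG', map_zero, sub_sub_cancel] at h
  have hx : ![x 0, x 1] = x := by
    funext i
    fin_cases i <;> rfl
  rw [← hx]
  exact h.symm

end Fermat

/-! ## Part E. The parabola surface: an instance of the open case where the answer is YES -/

section Instance

open Complex

/-- **`S_par` decides an instance of Mantova–Masser's question**: `W = S_par` satisfies all five
hypotheses `MMCaseDimPiOneFree` of Mantova–Masser's question (irreducible Zariski closed, torus
part non-empty, `dim W = 2`, `dim cl π(S) = 1`, `cl π(S)` not a line of rational slope — case
(dim-pi-S-1-free)) AND its conclusion `I(W ∩ Γ_exp) = I(W)`. (The general question remains open.)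
(new in this file) [folklore] -/
theorem unprojectedDensityQuestion_instance_mmParabola :
    MMCaseDimPiOneFree mmParabola ∧ UnprojectedDense mmParabola :=
  ⟨⟨isIrreducibleClosed_mmParabola, mmParabola_inter_torusLocus_nonempty, zariskiDim_mmParabola,
    addProjDim_mmParabola, not_isRationalSlopeLine_mmParabola⟩,
    vanishingIdeal_mmParabola_inter_expGraph⟩

/-- The exponential points of `S_par` are infinite (consistent with Mantova–Masser's Thm 1.2, case
(dim-pi-S-1-free)); here read off the degenerate-escape sequence directly. [folklore] -/
theorem mmParabola_inter_expGraph_infinite : (mmParabola ∩ expGraph ℂ 2).Infinite := by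
  have hinj : Function.Injective fun k => mmParam (escapeSeq k) (escapeW k) := by
    intro k l h
    have h0 := congr_fun h (Sum.inl 0)
    simp only [mmParam_inl_zero] at h0
    by_contra hkl
    have hne : (k : ℝ) + 1 ≠ (l : ℝ) + 1 := by
      intro h'; exact hkl (by exact_mod_cast (add_right_cancel h'))
    -- the centres are `2π` apart, the points within `1/2` of their centres
    have hk := (escapeSeq_spec k).1
    have hl := (escapeSeq_spec l).1
    rw [h0] at hk
    have hdist : ‖escCentre k - escCentre l‖ ≤ 1 := by
      have := norm_sub_le (escCentre k - escapeSeq l) (escCentre l - escapeSeq l)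
      rw [sub_sub_sub_cancel_right] at this
      rw [norm_sub_rev] at hk hl
      linarith
    have hcd : ‖escCentre k - escCentre l‖ = 2 * Real.pi * |((k : ℝ) + 1) - ((l : ℝ) + 1)| := by
      rw [escCentre, escCentre, show (2 * Real.pi * ((k : ℝ) + 1) * I - 2 * Real.pi * ((l : ℝ) + 1) * I
        : ℂ) = ((2 * Real.pi * (((k : ℝ) + 1) - ((l : ℝ) + 1)) : ℝ) : ℂ) * I by push_cast; ring,
        norm_mul, norm_I, mul_one, Complex.norm_real, Real.norm_eq_abs, abs_mul,
        abs_of_pos Real.two_pi_pos]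
    have hint : (1 : ℝ) ≤ |((k : ℝ) + 1) - ((l : ℝ) + 1)| := by
      rw [add_sub_add_right_eq_sub, ← Int.cast_natCast k, ← Int.cast_natCast l, ← Int.cast_sub,
        ← Int.cast_abs, ← Int.cast_one, Int.cast_le]
      have : (k : ℤ) ≠ l := by exact_mod_cast fun h' => hkl h'
      exact Int.one_le_abs (sub_ne_zero.2 this)
    have hπ := Real.pi_gt_three
    rw [hcd] at hdist
    nlinarith
  refine Set.infinite_of_injective_forall_mem hinj fun k => ?_
  exact ⟨mmParam_mem _ _, mmParam_mem_expGraph rfl (exp_escapeSeq k)⟩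

end Instance

end Literature.ModelTheory.Zilber
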